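import Summits.AtomisticToContinuum.BoseEinsteinCondensation.Theorems.GaussianDominationCan.Negative.Structure

/-!
# Crux `GaussianDominationCan` — structure of its operators II: the `P_i` commute and are linear

Support file (crux disprover, `stmt-AtomisticToContinuum-9479`).  On continuous functions the crux's
cell averages commute, `P_i P_j = P_j P_i` (Fubini on `cell × cell`, continuity on the compact
closed box), and are linear (`cellAvg_add`, `cellAvg_sub`, `cellAvg_const_mul`).  With
`Structure.lean` (idempotence, self-adjointness) this makes `{P_i}` a commuting family of orthogonal
projections on the continuous periodic functions — the input for the orthogonal resolution
`Σ_S Q_S = 1` and `‖Θ‖² ≤ 1/N`.  All [folklore].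
-/

noncomputable section

namespace Summit.AtomisticToContinuum.BoseEinsteinCondensation.Theorems.GaussianDominationCan.Negative

open MeasureTheory Literature.MathematicalPhysics.QuantumManyBody.BoseGas
open scoped ENNReal NNReal ComplexConjugate

variable {N : ℕ} {L : ℝ}

/-- **The `P_i` commute** on continuous functions (`i ≠ j`: Fubini on `cell × cell`). [folklore] -/
theorem cellAvg_comm (i j : Fin N) {g : Config N → ℂ} (hg : Continuous g) :
    cellAvg N L i (cellAvg N L j g) = cellAvg N L j (cellAvg N L i g) := by
  by_cases hij : i = j
  · subst hij; rfl
  funext X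
  unfold cellAvg
  simp only [integral_smul]
  congr 1
  congr 1
  have hF : Continuous fun p : Space × Space =>
      g (Function.update (Function.update X i p.1) j p.2) :=
    hg.comp (((continuous_const (y := X)).update i continuous_fst).update j continuous_snd)
  have hint : Integrable (Function.uncurry fun y z =>
      g (Function.update (Function.update X i y) j z))
      (((volume : Measure Space).restrict (cell L)).prod
        ((volume : Measure Space).restrict (cell L))) := by
    rw [Measure.prod_restrict]
    have hK := (isCompact_closedBox L).prod (isCompact_closedBox L)
    exact (hF.continuousOn.integrableOn_compact hK).mono_set
      (Set.prod_mono (cell_subset_closedBox L) (cell_subset_closedBox L))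
  rw [integral_integral_swap hint]
  refine integral_congr_ae (Filter.Eventually.of_forall fun z => ?_)
  refine integral_congr_ae (Filter.Eventually.of_forall fun y => ?_)
  simp only
  rw [Function.update_comm hij]

/-- `P_i` is additive on continuous functions. [folklore] -/
theorem cellAvg_add (i : Fin N) {f g : Config N → ℂ} (hf : Continuous f) (hg : Continuous g) :
    cellAvg N L i (f + g) = cellAvg N L i f + cellAvg N L i g := by
  funext X
  unfold cellAvg
  simp only [Pi.add_apply]
  rw [integral_add (integrableOn_cell (f := fun y => f (Function.update X i y))
      (hf.comp ((continuous_const (y := X)).update i continuous_id)))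
    (integrableOn_cell (f := fun y => g (Function.update X i y))
      (hg.comp ((continuous_const (y := X)).update i continuous_id))), smul_add]

/-- `P_i` is homogeneous. [folklore] -/
theorem cellAvg_const_mul (i : Fin N) (a : ℂ) (g : Config N → ℂ) :
    cellAvg N L i (fun X => a * g X) = fun X => a * cellAvg N L i g X := by
  funext X
  unfold cellAvg
  rw [integral_const_mul, mul_smul_comm]

/-- `P_i` commutes with subtraction (continuous functions). [folklore] -/
theorem cellAvg_sub (i : Fin N) {f g : Config N → ℂ} (hf : Continuous f) (hg : Continuous g) :
    cellAvg N L i (f - g) = cellAvg N L i f - cellAvg N L i g := by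
  funext X
  unfold cellAvg
  simp only [Pi.sub_apply]
  rw [integral_sub (integrableOn_cell (f := fun y => f (Function.update X i y))
      (hf.comp ((continuous_const (y := X)).update i continuous_id)))
    (integrableOn_cell (f := fun y => g (Function.update X i y))
      (hg.comp ((continuous_const (y := X)).update i continuous_id))), smul_sub]


end Summit.AtomisticToContinuum.BoseEinsteinCondensation.Theorems.GaussianDominationCan.Negative

end
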